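import Summits.HodgeConjecture.HodgeConjecture.Theorems.LinearSystemTorelliLocalTubeSpanMultiCluster
import Summits.HodgeConjecture.HodgeConjecture.Theorems.LinearSystemTorelliLocalTubeSpanClusterFrame

/-!
# Route LinearSystemTorelli — crux `LocalTubeSpan`: orthogonal complete clusters, from orbit data

Helper file (`--supports stmt-HodgeConjecture-2490`, line `Sketch`; the CAPSTONE of the algebraic
spine).  The local Schnell theorem at a point of the discriminant whose local vanishing cycles fall
into finitely many pairwise ORTHOGONAL Janssen-complete clusters (one per branch of the local
discriminant with big monodromy: several isolated singular points, the cone over the dual variety of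
the double locus of a two-component member, …) plus transversal NODES (smooth branches), stated
purely in terms of ORBIT DATA and conditional on the two results of W. Janssen, *Skew-symmetric
vanishing lattices and their monodromy groups*, Math. Ann. 266 (1983) that C. Schnell's argument
(*Primitive cohomology and the tube mapping*, Math. Z. 268 (2010) §7) rests on — recorded in
`Literature.AlgebraicGeometry.HodgeTheory.SkewVanishingLattice` as the named facts
`Schnell2010_lemma11` (Janssen Thm. 2.5 / Lemma 2.7 via Schnell's Lemma 11: the detecting frame) and
`Janssen1983_thm2_9` (the companions `δ + 2β ∈ Δ`):

* `localTubeSpan_injective_evalCoinv_of_orthogonalClusters` — `G = ⟨s₀ ∪ ⋃_j s_j⟩` acting on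
  `V = H^{2p-1}(X_s, ℚ)_van` (nondegenerate alternating `B`) by Picard–Lefschetz transvections; for
  each cluster `j` the cycles `e(s_j)` lie in a single `⟨s_j⟩`-orbit `Δ_j` (stable, transitive,
  integral, `ℤΔ_j` f.g., a `⟨δ₁, δ₂⟩ = 1` pair, every `T_δ`, `δ ∈ Δ_j`, realised in `⟨s_j⟩`);
  distinct orbits orthogonal; node cycles non-zero and orthogonal to everything.  Then Schnell's
  third map `H¹(G, V) → ∏_g V/(g - 1)V` is injective.

Proof: `…ClusterFrame` turns Lemma 11 into the per-cluster frames, Theorem 2.9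
(`IsSkewVanishingLattice.add_two_smul_mem` on the degenerate lattice `(ℚΔ_j, Δ_j)`) into the
companions, and `…MultiCluster` concludes.
-/

-- `Summit.HodgeConjecture.HodgeConjecture.Theorems` is the mandated namespace (single-conjunct summit:
-- Sub = Summit), which `linter.dupNamespace` flags on every declaration; the lakefile turns the
-- linter off tree-wide (weak option), restated here so stand-alone elaboration is warning-free too.
set_option linter.dupNamespace false

noncomputable section

open CategoryTheory groupCohomology
open Literature.AlgebraicGeometry.HodgeTheory

namespace Summit.HodgeConjecture.HodgeConjecture.Theorems

section Clusters

variable {G : Type} [Group G] (A : Rep.{0} ℚ G)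

/-- Every element of the `ℚ`-span of a set has a positive integer multiple in its `ℤ`-span
(clearing denominators). [folklore] -/
theorem localTubeSpan_exists_nsmul_mem_span_int {V : Type} [AddCommGroup V] [Module ℚ V]
    (Δ : Set V) {x : V} (hx : x ∈ Submodule.span ℚ Δ) :
    ∃ N : ℕ, 0 < N ∧ (N : ℚ) • x ∈ Submodule.span ℤ Δ := by
  refine Submodule.span_induction (fun y hy => ⟨1, one_pos, ?_⟩) ⟨1, one_pos, by simp⟩
    (fun y z _ _ hy hz => ?_) (fun q y _ hy => ?_) hx
  · rw [Nat.cast_one, one_smul]; exact Submodule.subset_span hy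
  · obtain ⟨N, hN, hyN⟩ := hy
    obtain ⟨M, hM, hzM⟩ := hz
    refine ⟨N * M, Nat.mul_pos hN hM, ?_⟩
    rw [Nat.cast_mul, smul_add]
    refine Submodule.add_mem _ ?_ ?_
    · have e1 : ((N : ℚ) * M) • y = M • ((N : ℚ) • y) := by
        rw [mul_comm, mul_smul]; exact Nat.cast_smul_eq_nsmul ℚ M _
      rw [e1]
      exact Submodule.smul_of_tower_mem _ M hyN
    · have e1 : ((N : ℚ) * M) • z = N • ((M : ℚ) • z) := by
        rw [mul_smul]; exact Nat.cast_smul_eq_nsmul ℚ N _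
      rw [e1]
      exact Submodule.smul_of_tower_mem _ N hzM
  · obtain ⟨N, hN, hyN⟩ := hy
    refine ⟨q.den * N, Nat.mul_pos q.den_pos hN, ?_⟩
    have e1 : ((q.den * N : ℕ) : ℚ) • q • y = q.num • ((N : ℚ) • y) := by
      rw [smul_smul, Nat.cast_mul, mul_assoc, mul_comm (N : ℚ), ← mul_assoc, Rat.den_mul_eq_num,
        ← smul_smul, Int.cast_smul_eq_zsmul]
    rw [e1]
    exact Submodule.smul_mem _ _ hyN

/-- **The local Schnell theorem at a point with orthogonal complete clusters and nodes**, from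
orbit data, conditional on Janssen's Theorems 2.5 (through Schnell's Lemma 11) and 2.9 — see the
module docstring for the hypotheses. [cite: Schnell2010, §7 Prop. 12 and Lemma 11]
[cite: Janssen1983, Thm. 2.9] -/
theorem localTubeSpan_injective_evalCoinv_of_orthogonalClusters (hL11 : Schnell2010_lemma11)
    (h29 : Janssen1983_thm2_9) [FiniteDimensional ℚ A.V]
    (B : LinearMap.BilinForm ℚ A.V) (hB : B.Nondegenerate) (hBalt : B.IsAlt)
    {b : ℕ} (s : Fin b → Set G) (s₀ : Set G) (hs : Subgroup.closure (s₀ ∪ ⋃ j, s j) = ⊤)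
    (e : G → A.V) (hPL : ∀ t ∈ s₀ ∪ ⋃ j, s j, ∀ x : A.V, A.ρ t x = x - B x (e t) • e t)
    (Δ : Fin b → Set A.V) (heΔ : ∀ (j : Fin b), ∀ t ∈ s j, e t ∈ Δ j)
    (hΔG : ∀ (j : Fin b), ∀ δ ∈ Δ j, ∃ g ∈ Subgroup.closure (s j), ∀ x : A.V, A.ρ g x = x - B x δ • δ)
    (hfg : ∀ j, (Submodule.span ℤ (Δ j)).FG)
    (hint : ∀ (j : Fin b), ∀ δ ∈ Δ j, ∀ δ' ∈ Δ j, ∃ n : ℤ, B δ δ' = n)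
    (hstable : ∀ (j : Fin b), ∀ g ∈ Subgroup.closure (s j), ∀ δ ∈ Δ j, A.ρ g δ ∈ Δ j)
    (htrans : ∀ (j : Fin b), ∀ δ ∈ Δ j, ∀ δ' ∈ Δ j, ∃ g ∈ Subgroup.closure (s j), A.ρ g δ = δ')
    (hpair : ∀ j, ∃ δ₁ ∈ Δ j, ∃ δ₂ ∈ Δ j, B δ₁ δ₂ = 1)
    (horthΔ : ∀ i j, i ≠ j → ∀ δ ∈ Δ i, ∀ δ' ∈ Δ j, B δ δ' = 0)
    (horth₀ : ∀ t ∈ s₀, (∀ t' ∈ s₀, B (e t) (e t') = 0) ∧ ∀ (j : Fin b), ∀ δ ∈ Δ j, B (e t) δ = 0)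
    (hne₀ : ∀ t ∈ s₀, e t ≠ 0) :
    Function.Injective (evalCoinv A) := by
  classical
  have hanti : ∀ x y : A.V, B x y = -B y x := fun x y => (hBalt.neg_eq y x).symm
  -- isometries (all generators are transvections of the alternating `B`)
  have hiso : ∀ (g : G) (x y : A.V), B (A.ρ g x) (A.ρ g y) = B x y :=
    localTubeSpan_isometry_of_generators B A.ρ _ hs fun t ht =>
      localTubeSpan_isometry_of_transvection_formula B hBalt (e t) (A.ρ t) (hPL t ht)
  -- the cluster lattices: `ℚΔ_j = ℚ e(s j)`
  have hΔsub : ∀ (j : Fin b), Δ j ⊆ Submodule.span ℚ (e '' s j) := by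
    intro j δ hδ
    by_cases hsj : (s j).Nonempty
    · obtain ⟨t₀, ht₀⟩ := hsj
      obtain ⟨g, hg, hgδ⟩ := htrans j (e t₀) (heΔ j t₀ ht₀) δ hδ
      rw [← hgδ]
      have h1 : A.ρ g (e t₀) - e t₀ ∈ Submodule.span ℚ (e '' s j) :=
        localTubeSpan_sub_mem_of_mem_closure A _ (s j) (fun t ht x => by
          rw [hPL t (Or.inr (Set.mem_iUnion.2 ⟨j, ht⟩)), sub_sub_cancel_left, ← neg_smul]
          exact Submodule.smul_mem _ _ (Submodule.subset_span ⟨t, ht, rfl⟩)) hg (e t₀)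
      have h2 : A.ρ g (e t₀) = (A.ρ g (e t₀) - e t₀) + e t₀ := by abel
      rw [h2]
      exact Submodule.add_mem _ h1 (Submodule.subset_span ⟨t₀, ht₀, rfl⟩)
    · -- `s j = ∅`: then `⟨s j⟩ = 1` realises `T_δ`, so `B(·, δ)δ = 0`, and the pair forces `δ`…
      -- in fact `Δ j` has the pair `δ₁, δ₂` with `T_{δ₁}` realised by `1`, absurd
      exfalso
      obtain ⟨δ₁, hδ₁, δ₂, hδ₂, h12⟩ := hpair j
      obtain ⟨g, hg, hgT⟩ := hΔG j δ₁ hδ₁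
      have hg1 : g = 1 := by
        have : Subgroup.closure (s j) = ⊥ := by
          rw [Set.not_nonempty_iff_eq_empty.1 hsj, Subgroup.closure_empty]
        rw [this] at hg
        exact Subgroup.mem_bot.1 hg
      have := hgT δ₂
      rw [hg1, map_one, Module.End.one_apply, eq_comm, sub_eq_self, smul_eq_zero] at this
      rcases this with h | h
      · rw [hanti, h12] at h; norm_num at h
      · rw [h, map_zero] at h12; exact zero_ne_one h12
  have hspanΔ : ∀ (j : Fin b), Submodule.span ℚ (Δ j) = Submodule.span ℚ (e '' s j) := fun j =>
    le_antisymm (Submodule.span_le.2 (hΔsub j))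
      (Submodule.span_mono (by rintro _ ⟨t, ht, rfl⟩; exact heΔ j t ht))
  -- `0 ∉ Δ_j`
  have hΔne : ∀ (j : Fin b), ∀ δ ∈ Δ j, δ ≠ 0 := by
    intro j δ hδ hδ0
    obtain ⟨δ₁, hδ₁, δ₂, hδ₂, h12⟩ := hpair j
    obtain ⟨g, -, hgδ⟩ := htrans j δ hδ δ₁ hδ₁
    rw [hδ0, map_zero] at hgδ
    rw [← hgδ, map_zero, LinearMap.zero_apply] at h12
    exact zero_ne_one h12
  -- no cluster cycle in the radical of its lattice
  have hnotR : ∀ (j : Fin b), ∀ t ∈ s j,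
      e t ∉ Submodule.span ℚ (e '' s j) ⊓ B.orthogonal (Submodule.span ℚ (e '' s j)) := by
    intro j t ht hR
    obtain ⟨δ₁, hδ₁, δ₂, hδ₂, h12⟩ := hpair j
    have horthall : ∀ δ' ∈ Δ j, ∀ y ∈ Submodule.span ℚ (e '' s j), B y δ' = 0 := by
      intro δ' hδ' y hy
      obtain ⟨g, hg, hgδ⟩ := htrans j (e t) (heΔ j t ht) δ' hδ'
      have hy' : A.ρ g⁻¹ y ∈ Submodule.span ℚ (e '' s j) := by
        have h1 := localTubeSpan_sub_mem_of_mem_closure A (Submodule.span ℚ (e '' s j)) (s j)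
          (fun t' ht' x => by
            rw [hPL t' (Or.inr (Set.mem_iUnion.2 ⟨j, ht'⟩)), sub_sub_cancel_left, ← neg_smul]
            exact Submodule.smul_mem _ _ (Submodule.subset_span ⟨t', ht', rfl⟩))
          (Subgroup.inv_mem _ hg) y
        have h2 : A.ρ g⁻¹ y = (A.ρ g⁻¹ y - y) + y := by abel
        rw [h2]; exact Submodule.add_mem _ h1 hy
      have e1 : B y δ' = B (A.ρ g⁻¹ y) (e t) := by
        rw [← hgδ, ← hiso g (A.ρ g⁻¹ y) (e t), ← Module.End.mul_apply, ← map_mul, mul_inv_cancel,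
          map_one, Module.End.one_apply]
      rw [e1]
      exact (LinearMap.BilinForm.mem_orthogonal_iff.1 hR.2) _ hy'
    have : B δ₁ δ₂ = 0 := horthall δ₂ hδ₂ δ₁ (hΔsub j hδ₁)
    rw [h12] at this
    exact one_ne_zero this
  -- per-cluster frames (Lemma 11)
  have hframes : ∀ j : Fin b, ∃ (r : ℕ) (u : Fin r → G) (δ' : Fin r → A.V),
      (∀ i, u i ∈ Subgroup.closure (s j)) ∧ (∀ i, δ' i ∈ Δ j) ∧ LinearIndependent ℚ δ' ∧
      (∀ (i : Fin r) (x : A.V), A.ρ (u i) x = x - B x (δ' i) • δ' i) ∧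
      ∀ t ∈ s j, ∃ m : ℕ, 0 < m ∧ ∃ γ ∈ Subgroup.closure (Set.range u),
        ∀ x ∈ Submodule.span ℚ (Δ j), A.ρ (t ^ m) x = A.ρ γ x := fun j =>
    localTubeSpan_exists_frame_of_completeOrbit_closure A hL11 B hBalt (Δ j) (s j)
      (fun t ht => ⟨e t, heΔ j t ht, hPL t (Or.inr (Set.mem_iUnion.2 ⟨j, ht⟩))⟩) (hΔG j) (hfg j)
      (hint j) (hstable j) (htrans j) (hpair j)
  choose r u δ' hu₁ _hδ'Δ hli hu hvirt using hframes
  -- companions (Theorem 2.9 on the degenerate lattice `(ℚΔ_j, Δ_j)`)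
  have hcomp : ∀ (j : Fin b), ∀ ℓ ∈ Submodule.span ℚ (e '' s j) ⊓ B.orthogonal (Submodule.span ℚ (e '' s j)),
      ℓ ≠ 0 → ∃ g₁ ∈ Subgroup.closure (s j), ∃ g₂ ∈ Subgroup.closure (s j), ∃ (a : A.V) (c : ℚ),
        a ≠ 0 ∧ a + c • ℓ ≠ 0 ∧ c ≠ 0 ∧ a ∈ Submodule.span ℚ (e '' s j) ∧
        (∀ x : A.V, A.ρ g₁ x = x - B x a • a) ∧
        (∀ x : A.V, A.ρ g₂ x = x - B x (a + c • ℓ) • (a + c • ℓ)) := by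
    intro j ℓ hℓ hℓ0
    -- a generator `t₀ ∈ s j` (the lattice is non-zero)
    have hsj : (s j).Nonempty := by
      by_contra hemp
      rw [Set.not_nonempty_iff_eq_empty] at hemp
      have : Submodule.span ℚ (e '' s j) = ⊥ := by rw [hemp, Set.image_empty, Submodule.span_empty]
      rw [this] at hℓ
      exact hℓ0 ((Submodule.mem_bot ℚ).1 hℓ.1)
    obtain ⟨t₀, ht₀⟩ := hsj
    -- an integral multiple `β = N ℓ ∈ ℤΔ_j`, orthogonal to `Δ_j`
    have hℓΔ : ℓ ∈ Submodule.span ℚ (Δ j) := by rw [hspanΔ]; exact hℓ.1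
    obtain ⟨N, hN, hβ⟩ := localTubeSpan_exists_nsmul_mem_span_int (Δ j) hℓΔ
    have hβrad : ∀ x ∈ Δ j, B ((N : ℚ) • ℓ) x = 0 := fun x hx => by
      rw [map_smul, LinearMap.smul_apply, hanti,
        (LinearMap.BilinForm.mem_orthogonal_iff.1 hℓ.2) x (hΔsub j hx), neg_zero, smul_zero]
    -- `Δ_j` is a skew vanishing lattice in its span: apply Theorem 2.9 there
    set L : Submodule ℚ A.V := Submodule.span ℚ (Δ j) with hL
    let B' : LinearMap.BilinForm ℚ L := B.restrict L
    have hB' : B'.IsAlt := fun x => hBalt (x : A.V)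
    let Δ' : Set L := {x : L | (x : A.V) ∈ Δ j}
    have hLstab : ∀ g ∈ Subgroup.closure (s j), ∀ x ∈ L, A.ρ g x ∈ L := fun g hg x hx => by
      have h1 := localTubeSpan_sub_mem_of_mem_closure A L (s j) (fun t ht y => by
        rw [hPL t (Or.inr (Set.mem_iUnion.2 ⟨j, ht⟩)), sub_sub_cancel_left, ← neg_smul]
        exact Submodule.smul_mem _ _ (Submodule.subset_span (heΔ j t ht))) hg x
      have h2 : A.ρ g x = (A.ρ g x - x) + x := by abel
      rw [h2]; exact Submodule.add_mem _ h1 hx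
    -- the restricted representation of `H_j = ⟨s j⟩` on `L`
    set H : Subgroup G := Subgroup.closure (s j) with hH
    let resL : H →* (L →ₗ[ℚ] L) :=
      { toFun := fun g => (A.ρ (g : G)).restrict (hLstab g g.2)
        map_one' := by
          refine LinearMap.ext fun x => Subtype.ext ?_
          simp
        map_mul' := fun g h => by
          refine LinearMap.ext fun x => Subtype.ext ?_
          simp }
    have hresL : ∀ (g : H) (x : L), ((resL g x : L) : A.V) = A.ρ (g : G) x := fun g x => rfl
    have hrestrT : ∀ (g : H) (δ : L), (∀ x : A.V, A.ρ (g : G) x = x - B x δ • (δ : A.V)) →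
        resL g = skewTransvection B' δ := fun g δ hg => by
      refine LinearMap.ext fun x => Subtype.ext ?_
      rw [hresL, hg, skewTransvection_apply, Submodule.coe_sub, Submodule.coe_smul]
      rfl
    let s' : Set H := ((↑) : H → G) ⁻¹' s j
    have hs' : Subgroup.closure s' = ⊤ := Subgroup.closure_closure_coe_preimage
    have hsT' : ∀ t ∈ s', ∃ δ ∈ Δ', resL t = skewTransvection B' δ := fun t ht =>
      ⟨⟨e t, Submodule.subset_span (heΔ j _ ht)⟩, heΔ j _ ht,
        hrestrT t ⟨e t, _⟩ (hPL _ (Or.inr (Set.mem_iUnion.2 ⟨j, ht⟩)))⟩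
    have hreal' : ∀ δ ∈ Δ', ∃ g : H, resL g = skewTransvection B' δ := fun δ hδ => by
      obtain ⟨g, hg, hgT⟩ := hΔG j (δ : A.V) hδ
      exact ⟨⟨g, hg⟩, hrestrT ⟨g, hg⟩ δ hgT⟩
    have hΔ' : IsSkewVanishingLattice B' Δ' := by
      refine ⟨?_, ?_, ?_, ?_, ?_, ?_⟩
      · let ι : L →ₗ[ℤ] A.V := L.subtype.restrictScalars ℤ
        refine Submodule.fg_of_fg_map_injective ι (fun x y h => Subtype.ext h) ?_
        have himg : (ι : L → A.V) '' Δ' = Δ j := by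
          ext v
          constructor
          · rintro ⟨x, hx, rfl⟩; exact hx
          · intro hv; exact ⟨⟨v, Submodule.subset_span hv⟩, hv, rfl⟩
        rw [Submodule.map_span, himg]
        exact hfg j
      · intro δ hδ δ'' hδ''
        exact hint j _ hδ _ hδ''
      · exact Submodule.span_span_coe_preimage
      · intro γ hγ δ hδ
        obtain ⟨g, hg⟩ :=
          localTubeSpan_exists_toHomUnits_eq_of_mem_transvectionGroup B' Δ' resL s' hs' hsT' hreal' hγ
        change ((γ : L →ₗ[ℚ] L) δ : A.V) ∈ Δ j
        rw [← hg, hresL]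
        exact hstable j _ g.2 _ hδ
      · intro δ hδ δ'' hδ''
        obtain ⟨g, hg, hgδ⟩ := htrans j _ hδ _ hδ''
        refine ⟨resL.toHomUnits ⟨g, hg⟩,
          localTubeSpan_toHomUnits_mem_transvectionGroup B' Δ' resL s' hs' hsT' hreal' _, ?_⟩
        exact Subtype.ext (by rw [MonoidHom.coe_toHomUnits, hresL, hgδ])
      · obtain ⟨δ₁, hδ₁, δ₂, hδ₂, h12⟩ := hpair j
        exact ⟨⟨δ₁, Submodule.subset_span hδ₁⟩, hδ₁, ⟨δ₂, Submodule.subset_span hδ₂⟩, hδ₂, h12⟩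
    -- Theorem 2.9: `e t₀ + 2β ∈ Δ_j`
    have hβL : ((N : ℚ) • ℓ) ∈ L := L.smul_mem _ hℓΔ
    have hβ' : (⟨(N : ℚ) • ℓ, hβL⟩ : L) ∈ Submodule.span ℤ Δ' := by
      -- `ℤΔ'` is the preimage of `ℤΔ_j` under the injective `L → V`
      have key : ∀ (y : L), (y : A.V) ∈ Submodule.span ℤ (Δ j) → y ∈ Submodule.span ℤ Δ' := by
        intro y hy
        have hy' := hy
        refine Submodule.span_induction (p := fun v _ => ∀ (w : L), (w : A.V) = v → w ∈ Submodule.span ℤ Δ')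
          ?_ ?_ ?_ ?_ hy' y rfl
        · intro v hv w hw
          exact Submodule.subset_span (show (w : A.V) ∈ Δ j by rw [hw]; exact hv)
        · intro w hw
          have : w = 0 := Subtype.ext hw
          rw [this]; exact Submodule.zero_mem _
        · intro v v' hv hv' ihv ihv' w hw
          have hvL : v ∈ L := Submodule.span_le.2 (fun x hx => Submodule.subset_span hx)
            (Submodule.span_subset_span ℤ ℚ (Δ j) hv)
          have hv'L : v' ∈ L := Submodule.span_le.2 (fun x hx => Submodule.subset_span hx)
            (Submodule.span_subset_span ℤ ℚ (Δ j) hv')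
          have e1 : w = ⟨v, hvL⟩ + ⟨v', hv'L⟩ := Subtype.ext (by rw [hw]; rfl)
          rw [e1]
          exact Submodule.add_mem _ (ihv _ rfl) (ihv' _ rfl)
        · intro n v hv ih w hw
          have hvL : v ∈ L := Submodule.span_le.2 (fun x hx => Submodule.subset_span hx)
            (Submodule.span_subset_span ℤ ℚ (Δ j) hv)
          have e1 : w = n • ⟨v, hvL⟩ := Subtype.ext (by rw [hw]; rfl)
          rw [e1]
          exact Submodule.smul_mem _ _ (ih _ rfl)
      exact key _ hβ
    have hmem : (⟨e t₀, Submodule.subset_span (heΔ j t₀ ht₀)⟩ : L) + 2 • ⟨(N : ℚ) • ℓ, hβL⟩ ∈ Δ' :=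
      IsSkewVanishingLattice.add_two_smul_mem h29 hB' hΔ' (heΔ j t₀ ht₀) hβ' fun x hx => hβrad _ hx
    have hmemV : e t₀ + ((2 * N : ℕ) : ℚ) • ℓ ∈ Δ j := by
      have : (((⟨e t₀, Submodule.subset_span (heΔ j t₀ ht₀)⟩ : L) + 2 • (⟨(N : ℚ) • ℓ, hβL⟩ : L) :
          L) : A.V) = e t₀ + ((2 * N : ℕ) : ℚ) • ℓ := by
        rw [Submodule.coe_add, Submodule.coe_smul_of_tower, two_nsmul, Nat.cast_mul, Nat.cast_ofNat,
          two_mul, add_smul]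
      rw [← this]
      exact hmem
    obtain ⟨g₂, hg₂, hg₂T⟩ := hΔG j _ hmemV
    refine ⟨t₀, Subgroup.subset_closure ht₀, g₂, hg₂, e t₀, ((2 * N : ℕ) : ℚ),
      hΔne j _ (heΔ j t₀ ht₀), hΔne j _ hmemV, by positivity,
      Submodule.subset_span ⟨t₀, ht₀, rfl⟩,
      hPL t₀ (Or.inr (Set.mem_iUnion.2 ⟨j, ht₀⟩)), hg₂T⟩
  -- orthogonality at the level of generators
  have horth : ∀ i j, i ≠ j → ∀ t ∈ s i, ∀ t' ∈ s j, B (e t) (e t') = 0 :=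
    fun i j hij t ht t' ht' => horthΔ i j hij _ (heΔ i t ht) _ (heΔ j t' ht')
  have horth₀' : ∀ t ∈ s₀, ∀ t' ∈ s₀ ∪ ⋃ j, s j, B (e t) (e t') = 0 := by
    rintro t ht t' (ht' | ht')
    · exact (horth₀ t ht).1 t' ht'
    · obtain ⟨j, htj⟩ := Set.mem_iUnion.1 ht'
      exact (horth₀ t ht).2 j _ (heΔ j t' htj)
  -- conclude with the multi-cluster theorem
  exact localTubeSpan_injective_evalCoinv_of_multiCluster A B hB hBalt s s₀ hs e hPL horth horth₀'
    hne₀ hnotR r u hu₁ δ' hli hu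
    (fun j t ht => by
      obtain ⟨m, hm, γ, hγ, hγL⟩ := hvirt j t ht
      exact ⟨m, hm, γ, hγ, fun x hx => hγL x (by rw [hspanΔ]; exact hx)⟩)
    hcomp

end Clusters

end Summit.HodgeConjecture.HodgeConjecture.Theorems

end
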